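import Literature.Analysis.Fourier.LogPhaseIntegral
import Literature.NumberTheory.LFunctions.TwistedMomentSums
import HarnessLib

/-!
# Titchmarsh's Lemma 9.22: `∫_T^{T₂} z₁(t)² (n/m)^{it} dt`

Topic `Literature/NumberTheory/LFunctions`. Everything in this file is PROVED (no definitions, no
named facts).

Let `T` be large, `T ≤ T₂ ≤ 2T`, `U = T₂ − T`, `P = ⌊(T/2π)^{1/2}⌋`,
`S₁(t) = ∑_{μ ≤ P} μ^{-1/2-it}`, and let `m, n ≤ X` be coprime. Titchmarsh, *The Theory of the
Riemann Zeta-Function*, Lemma 9.22, evaluates the "cross term" of the mollified mean square of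
`Z(t)` on `[T, T₂]`,

  `J = ∫_T^{T₂} e^{i(t log(t/2π) − t − π/4)} S₁(t)² (n/m)^{it} dt`
  `  = e^{-iπ/4} ∑_{μ,ν ≤ P} (μν)^{-1/2} ∫_T^{T₂} e^{i t log(t/(ec))} dt`,  `c = 2πμνm/n`,

(here `e^{i(t log(t/2π) − t − π/4)}` is the main term of `e^{2iϑ(t)}`, `ϑ` the Riemann–Siegel theta
function, so that `e^{2iϑ} S₁² = z₁²` up to `O(1/t)`), by the stationary-phase evaluation (9.22.2)
of the inner integrals (tree: `Literature.Analysis.Fourier.norm_logPhaseIntegral_sub_indicator_main_le`)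
and the arithmetic of the resulting main terms `2π (m/n)^{1/2} ∑∑_{T ≤ 2πμνm/n ≤ T₂} e^{-2πiμνm/n}`
(geometric sums in `ν`, non-trivial only for `n ∣ μ`; tree:
`Literature.NumberTheory.LFunctions.TwistedMoment.norm_sum_cexp_rational_le`):

* `Literature.NumberTheory.LFunctions.TwistedMoment.lemma922` — **Lemma 9.22**:
  `‖J − (U/(mn)^{1/2}) ∑_{r₀ ≤ r ≤ P/n} 1/r‖ ≤ E` with `r₀ = ⌈T/(2π m P)⌉` (Titchmarsh's
  `∑_{τ/m ≤ r ≤ τ/n} 1/r`, "to be omitted if `m < n`") and the explicit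
  `E = 160 T^{2/5} P + 480 P + 440 X^{1/2} P + 320 (TX)^{1/2}(1 + log P)(2 + log P + log 3TX)`
  `    + 2π X^{1/2} (P + PX/2 + (U/(2πP) + 1) UP/T)`
  (`= O(T^{9/10} + (TX)^{1/2} X^{1/2} log² T + X^{3/2} T^{1/2} + X^{1/2} U²/T)`), valid for
  `4 ≤ T ≤ T₂ ≤ 2T`, `P² ≤ T/2π`, `1 ≤ m, n ≤ X ≤ P`.

The intermediate results are stated separately: the expansion `lemma922_integrand_eq` /
`lemma922_integral_eq`, the summed error terms `lemma922_error_le`, the main term of one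
stationary point `lemma922_mainTerm_eq`, the range of stationary `ν` `sum_Icc_ite_stationary_eq`,
the split of the `μ`-sum by `n ∣ μ` `lemma922_mu_sum_split`, and the count of stationary points
`lemma922_count_sum`.

## References

* E. C. Titchmarsh, *The Theory of the Riemann Zeta-Function*, 2nd ed. (rev. D. R. Heath-Brown),
  Oxford 1986, §9.22, Lemma 9.22 and eqs. (9.22.1)–(9.22.3). [cite: Titchmarsh1986, Lemma 9.22]
* A. Selberg, *On the zeros of Riemann's zeta-function*, Skr. Norske Vid.-Akad. Oslo I 1942,
  no. 10 (the source of §§9.20–9.24).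
-/

noncomputable section

open Finset Real Complex MeasureTheory Set intervalIntegral
open Literature.Analysis.Fourier

namespace Literature.NumberTheory.LFunctions.TwistedMoment

/-! ### The integrand as a double sum of log-phase exponentials -/

/-- The phases combine: for `t, c₀ > 0` with `c₀ = 2πμνm/n`,
`e^{i(t log(t/2π) − t − π/4)} μ^{-it} ν^{-it} (n/m)^{it} = e^{-iπ/4} e^{i t log(t/(e c₀))}`. [cite: Titchmarsh1986, §9.22] -/
theorem lemma922_phase_eq {t : ℝ} (ht : 0 < t) {μ ν m n : ℕ} (hμ : 0 < μ) (hν : 0 < ν) (hm : 0 < m)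
    (hn : 0 < n) :
    cexp (I * ((t * Real.log (t / (2 * π)) - t - π / 4 : ℝ) : ℂ))
        * (cexp (-(I * t * Real.log μ)) * cexp (-(I * t * Real.log ν)))
        * cexp (I * t * ((Real.log n - Real.log m : ℝ) : ℂ)) =
      cexp (-(I * (π / 4 : ℝ))) *
        cexp (I * ((t * Real.log (t / (Real.exp 1 * (2 * π * μ * ν * m / n))) : ℝ) : ℂ)) := by
  have hμR : (0 : ℝ) < μ := by exact_mod_cast hμ
  have hνR : (0 : ℝ) < ν := by exact_mod_cast hν
  have hmR : (0 : ℝ) < m := by exact_mod_cast hm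
  have hnR : (0 : ℝ) < n := by exact_mod_cast hn
  have h2π : (0 : ℝ) < 2 * π := by positivity
  set c₀ : ℝ := 2 * π * μ * ν * m / n with hc₀
  have hc₀pos : 0 < c₀ := by positivity
  -- the real identity of the exponents
  have hlogc : Real.log c₀ = Real.log (2 * π) + Real.log μ + Real.log ν + Real.log m - Real.log n := by
    rw [hc₀, Real.log_div (by positivity) hnR.ne', Real.log_mul (by positivity) hmR.ne',
      Real.log_mul (by positivity) hνR.ne', Real.log_mul h2π.ne' hμR.ne']
  have hkey : t * Real.log (t / (2 * π)) - t - π / 4 - t * Real.log μ - t * Real.log ν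
      + t * (Real.log n - Real.log m) =
      -(π / 4) + t * Real.log (t / (Real.exp 1 * c₀)) := by
    rw [Real.log_div ht.ne' h2π.ne', Real.log_div ht.ne' (by positivity),
      Real.log_mul (Real.exp_pos 1).ne' hc₀pos.ne', Real.log_exp, hlogc]
    ring
  simp only [← Complex.exp_add]
  congr 1
  have := congrArg (fun x : ℝ => (x : ℂ) * I) hkey
  push_cast at this ⊢
  linear_combination this

/-- `(μν)^{-1/2} = μ^{-1/2} ν^{-1/2}` as complex numbers. [folklore] -/
theorem rpow_neg_half_mul_cast (μ ν : ℕ) :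
    ((((μ : ℝ) * ν) ^ (-(1 / 2 : ℝ)) : ℝ) : ℂ) =
      (((μ : ℝ) ^ (-(1 / 2 : ℝ)) : ℝ) : ℂ) * (((ν : ℝ) ^ (-(1 / 2 : ℝ)) : ℝ) : ℂ) := by
  rw [← Complex.ofReal_mul, Real.mul_rpow (Nat.cast_nonneg μ) (Nat.cast_nonneg ν)]

/-- **The integrand of Lemma 9.22 as a double sum** (Titchmarsh §9.22, first display: "The
left-hand side is `e^{-¼πi} ∑_{μ ≤ τ} ∑_{ν ≤ τ} (μν)^{-1/2} ∫_T^{T+U} (t n/(2πe μν m))^{it} dt`"):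
for `t > 0`,
`e^{i(t log(t/2π) − t − π/4)} S₁(t)² (n/m)^{it} = e^{-iπ/4} ∑_{μ,ν ≤ P} (μν)^{-1/2} e^{i t log(t/(e c_{μν}))}`,
`c_{μν} = 2πμνm/n`. [cite: Titchmarsh1986, §9.22] -/
theorem lemma922_integrand_eq (P : ℕ) {m n : ℕ} (hm : 0 < m) (hn : 0 < n) {t : ℝ} (ht : 0 < t) :
    cexp (I * ((t * Real.log (t / (2 * π)) - t - π / 4 : ℝ) : ℂ))
        * (∑ μ ∈ Finset.Icc 1 P, (((μ : ℝ) ^ (-(1 / 2 : ℝ)) : ℝ) : ℂ) * cexp (-(I * t * Real.log μ))) ^ 2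
        * cexp (I * t * ((Real.log n - Real.log m : ℝ) : ℂ)) =
      cexp (-(I * (π / 4 : ℝ))) * ∑ μ ∈ Finset.Icc 1 P, ∑ ν ∈ Finset.Icc 1 P,
        ((((μ : ℝ) * ν) ^ (-(1 / 2 : ℝ)) : ℝ) : ℂ) *
          cexp (I * ((t * Real.log (t / (Real.exp 1 * (2 * π * μ * ν * m / n))) : ℝ) : ℂ)) := by
  rw [sq, Finset.sum_mul_sum, Finset.mul_sum, Finset.sum_mul, Finset.mul_sum]
  refine Finset.sum_congr rfl fun μ hμ => ?_
  rw [Finset.mul_sum, Finset.sum_mul, Finset.mul_sum]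
  refine Finset.sum_congr rfl fun ν hν => ?_
  have hμ0 : 0 < μ := (Finset.mem_Icc.1 hμ).1
  have hν0 : 0 < ν := (Finset.mem_Icc.1 hν).1
  have hph := lemma922_phase_eq ht hμ0 hν0 hm hn
  rw [rpow_neg_half_mul_cast]
  calc cexp (I * ((t * Real.log (t / (2 * π)) - t - π / 4 : ℝ) : ℂ)) *
        ((((μ : ℝ) ^ (-(1 / 2 : ℝ)) : ℝ) : ℂ) * cexp (-(I * t * Real.log μ)) *
          ((((ν : ℝ) ^ (-(1 / 2 : ℝ)) : ℝ) : ℂ) * cexp (-(I * t * Real.log ν)))) *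
        cexp (I * t * ((Real.log n - Real.log m : ℝ) : ℂ))
      = (((μ : ℝ) ^ (-(1 / 2 : ℝ)) : ℝ) : ℂ) * (((ν : ℝ) ^ (-(1 / 2 : ℝ)) : ℝ) : ℂ) *
        (cexp (I * ((t * Real.log (t / (2 * π)) - t - π / 4 : ℝ) : ℂ))
          * (cexp (-(I * t * Real.log μ)) * cexp (-(I * t * Real.log ν)))
          * cexp (I * t * ((Real.log n - Real.log m : ℝ) : ℂ))) := by ring
    _ = _ := by rw [hph]; ring

/-! ### Interchanging the integral with the double sum -/

/-- Continuity of `t ↦ e^{i t log(t/(e c))}` on `(0, ∞)`. [folklore] -/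
theorem continuousOn_logPhase_exp (c : ℝ) :
    ContinuousOn (fun t : ℝ => cexp (I * ((t * Real.log (t / (Real.exp 1 * c))) : ℝ) : ℂ)) (Ioi 0) := by
  refine Complex.continuous_exp.comp_continuousOn ?_
  refine (continuous_const.mul Complex.continuous_ofReal).comp_continuousOn ?_
  refine continuousOn_id.mul ?_
  by_cases hc : Real.exp 1 * c = 0
  · simp only [hc, div_zero, Real.log_zero]; exact continuousOn_const
  · exact Real.continuousOn_log.comp (continuousOn_id.div_const _) fun t ht => by
      exact div_ne_zero (Set.mem_Ioi.1 ht).ne' hc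

/-- **`J = e^{-iπ/4} ∑∑ (μν)^{-1/2} ∫_T^{T₂} e^{i t log(t/(e c_{μν}))} dt`** for `0 < T ≤ T₂`.
[cite: Titchmarsh1986, §9.22] -/
theorem lemma922_integral_eq (P : ℕ) {m n : ℕ} (hm : 0 < m) (hn : 0 < n) {T T₂ : ℝ} (hT : 0 < T)
    (hTT₂ : T ≤ T₂) :
    (∫ t in T..T₂, cexp (I * ((t * Real.log (t / (2 * π)) - t - π / 4 : ℝ) : ℂ))
        * (∑ μ ∈ Finset.Icc 1 P, (((μ : ℝ) ^ (-(1 / 2 : ℝ)) : ℝ) : ℂ) * cexp (-(I * t * Real.log μ))) ^ 2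
        * cexp (I * t * ((Real.log n - Real.log m : ℝ) : ℂ))) =
      cexp (-(I * (π / 4 : ℝ))) * ∑ μ ∈ Finset.Icc 1 P, ∑ ν ∈ Finset.Icc 1 P,
        ((((μ : ℝ) * ν) ^ (-(1 / 2 : ℝ)) : ℝ) : ℂ) *
          ∫ t in T..T₂, cexp (I * ((t * Real.log (t / (Real.exp 1 * (2 * π * μ * ν * m / n))) : ℝ) : ℂ)) := by
  have hIcc : ∀ t ∈ uIcc T T₂, 0 < t := fun t ht => by
    rw [uIcc_of_le hTT₂] at ht; exact hT.trans_le ht.1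
  -- rewrite the integrand
  have h1 : ∫ t in T..T₂, cexp (I * ((t * Real.log (t / (2 * π)) - t - π / 4 : ℝ) : ℂ))
        * (∑ μ ∈ Finset.Icc 1 P, (((μ : ℝ) ^ (-(1 / 2 : ℝ)) : ℝ) : ℂ) * cexp (-(I * t * Real.log μ))) ^ 2
        * cexp (I * t * ((Real.log n - Real.log m : ℝ) : ℂ)) =
      ∫ t in T..T₂, cexp (-(I * (π / 4 : ℝ))) * ∑ μ ∈ Finset.Icc 1 P, ∑ ν ∈ Finset.Icc 1 P,
        ((((μ : ℝ) * ν) ^ (-(1 / 2 : ℝ)) : ℝ) : ℂ) *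
          cexp (I * ((t * Real.log (t / (Real.exp 1 * (2 * π * μ * ν * m / n))) : ℝ) : ℂ)) :=
    intervalIntegral.integral_congr fun t ht => lemma922_integrand_eq P hm hn (hIcc t ht)
  rw [h1, intervalIntegral.integral_const_mul]
  congr 1
  -- integrability of each term
  have hint : ∀ μ ν : ℕ, IntervalIntegrable (fun t : ℝ =>
      ((((μ : ℝ) * ν) ^ (-(1 / 2 : ℝ)) : ℝ) : ℂ) *
        cexp (I * ((t * Real.log (t / (Real.exp 1 * (2 * π * μ * ν * m / n))) : ℝ) : ℂ))) volume T T₂ := by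
    intro μ ν
    refine (ContinuousOn.intervalIntegrable ?_)
    refine continuousOn_const.mul ((continuousOn_logPhase_exp _).mono fun t ht => ?_)
    exact hIcc t ht
  rw [intervalIntegral.integral_finsetSum fun μ _ =>
    (intervalIntegrable_finset_sum' ?_)]
  · refine Finset.sum_congr rfl fun μ _ => ?_
    rw [intervalIntegral.integral_finsetSum fun ν _ => hint μ ν]
    refine Finset.sum_congr rfl fun ν _ => ?_
    exact intervalIntegral.integral_const_mul _ _
  · exact fun ν _ => hint μ ν
  where
  /-- finite sums of interval-integrable functions (pointwise-sum form). -/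
  intervalIntegrable_finset_sum' {ι : Type} {s : Finset ι} {f : ι → ℝ → ℂ} {a b : ℝ}
      (h : ∀ i ∈ s, IntervalIntegrable (f i) volume a b) :
      IntervalIntegrable (fun t => ∑ i ∈ s, f i t) volume a b := by
    have := IntervalIntegrable.sum s h
    refine this.congr (fun t => ?_)
    simp [Finset.sum_apply]

/-! ### The error terms (Titchmarsh's `O(T^{2/5})` and `O{min(1/|log(c/T)|, T^{1/2})}` terms summed) -/

/-- The `μ`-sum of the bounds of `Literature.NumberTheory.LFunctions.TwistedMoment.sum_rpow_div_max_log_le`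
with `ν₀ = K/μ`, `K ≥ P ≥ 1`:
`∑_{μ ≤ P} μ^{-1/2} (6√P + 3B (K/μ)^{-1/2} + 10 (K/μ)^{1/2} (2 + log P + log ⌈K/μ⌉))`
`  ≤ 12 P + 3 B P K^{-1/2} + 10 K^{1/2} (1 + log P)(2 + log P + log ⌈K⌉)`. [folklore] -/
theorem weighted_mu_sum_le {P : ℕ} (hP : 1 ≤ P) {K : ℝ} (B : ℝ) (hK : (P : ℝ) ≤ K) :
    ∑ μ ∈ Finset.Icc 1 P, (μ : ℝ) ^ (-(1 / 2 : ℝ)) *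
        (6 * Real.sqrt P + 3 * B / Real.sqrt (K / μ)
          + 10 * Real.sqrt (K / μ) * (2 + Real.log P + Real.log ⌈K / μ⌉₊)) ≤
      12 * P + 3 * B * P / Real.sqrt K
        + 10 * Real.sqrt K * (1 + Real.log P) * (2 + Real.log P + Real.log ⌈K⌉₊) := by
  have hP0 : (0 : ℝ) < P := by exact_mod_cast hP
  have hK0 : 0 < K := hP0.trans_le hK
  have hsK : 0 < Real.sqrt K := Real.sqrt_pos.2 hK0
  have hlogP : 0 ≤ Real.log (P : ℝ) := Real.log_natCast_nonneg P
  have hceilK : (1 : ℝ) ≤ ⌈K⌉₊ := by exact_mod_cast Nat.one_le_ceil_iff.2 hK0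
  have hlogK : 0 ≤ Real.log (⌈K⌉₊ : ℝ) := Real.log_nonneg hceilK
  -- termwise simplification
  have hterm : ∀ μ ∈ Finset.Icc 1 P, (μ : ℝ) ^ (-(1 / 2 : ℝ)) *
      (6 * Real.sqrt P + 3 * B / Real.sqrt (K / μ)
        + 10 * Real.sqrt (K / μ) * (2 + Real.log P + Real.log ⌈K / μ⌉₊)) ≤
      6 * Real.sqrt P * (μ : ℝ) ^ (-(1 / 2 : ℝ)) + 3 * B / Real.sqrt K
        + 10 * Real.sqrt K * (2 + Real.log P + Real.log ⌈K⌉₊) * (1 / μ) := by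
    intro μ hμ
    have hμ1 : (1 : ℝ) ≤ μ := by exact_mod_cast (Finset.mem_Icc.1 hμ).1
    have hμ0 : (0 : ℝ) < μ := by linarith
    have hsμ : 0 < Real.sqrt μ := Real.sqrt_pos.2 hμ0
    have hpow : (μ : ℝ) ^ (-(1 / 2 : ℝ)) = (Real.sqrt μ)⁻¹ := by
      rw [Real.rpow_neg hμ0.le, ← Real.sqrt_eq_rpow]
    have hsq : Real.sqrt (K / μ) = Real.sqrt K / Real.sqrt μ := Real.sqrt_div' K hμ0.le
    -- `log ⌈K/μ⌉ ≤ log ⌈K⌉`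
    have hceil1 : (1 : ℝ) ≤ ⌈K / μ⌉₊ := by
      exact_mod_cast Nat.one_le_ceil_iff.2 (div_pos hK0 hμ0)
    have hlogle : Real.log ⌈K / μ⌉₊ ≤ Real.log ⌈K⌉₊ := by
      refine Real.log_le_log (by linarith) ?_
      exact_mod_cast Nat.ceil_mono (div_le_self hK0.le hμ1)
    have hfac : 0 ≤ 2 + Real.log (P : ℝ) + Real.log ⌈K / μ⌉₊ := by
      have : 0 ≤ Real.log (⌈K / μ⌉₊ : ℝ) := Real.log_nonneg hceil1
      linarith
    rw [hpow, hsq]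
    have e1 : (Real.sqrt μ)⁻¹ * (3 * B / (Real.sqrt K / Real.sqrt μ)) = 3 * B / Real.sqrt K := by
      field_simp
    have e2 : (Real.sqrt μ)⁻¹ * (10 * (Real.sqrt K / Real.sqrt μ)) = 10 * Real.sqrt K * (1 / μ) := by
      rw [show (Real.sqrt μ)⁻¹ * (10 * (Real.sqrt K / Real.sqrt μ)) =
        10 * Real.sqrt K * ((Real.sqrt μ)⁻¹ * (Real.sqrt μ)⁻¹) by ring, ← mul_inv,
        Real.mul_self_sqrt hμ0.le, one_div]
    calc (Real.sqrt μ)⁻¹ * (6 * Real.sqrt P + 3 * B / (Real.sqrt K / Real.sqrt μ)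
          + 10 * (Real.sqrt K / Real.sqrt μ) * (2 + Real.log P + Real.log ⌈K / μ⌉₊))
        = 6 * Real.sqrt P * (Real.sqrt μ)⁻¹ + (Real.sqrt μ)⁻¹ * (3 * B / (Real.sqrt K / Real.sqrt μ))
          + (Real.sqrt μ)⁻¹ * (10 * (Real.sqrt K / Real.sqrt μ)) * (2 + Real.log P + Real.log ⌈K / μ⌉₊) := by
          ring
      _ = 6 * Real.sqrt P * (Real.sqrt μ)⁻¹ + 3 * B / Real.sqrt K
          + 10 * Real.sqrt K * (1 / μ) * (2 + Real.log P + Real.log ⌈K / μ⌉₊) := by rw [e1, e2]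
      _ ≤ 6 * Real.sqrt P * (Real.sqrt μ)⁻¹ + 3 * B / Real.sqrt K
          + 10 * Real.sqrt K * (1 / μ) * (2 + Real.log P + Real.log ⌈K⌉₊) := by
          have : 0 ≤ 10 * Real.sqrt K * (1 / (μ : ℝ)) := by positivity
          nlinarith
      _ = _ := by ring
  refine (Finset.sum_le_sum hterm).trans ?_
  rw [Finset.sum_add_distrib, Finset.sum_add_distrib, ← Finset.mul_sum, Finset.sum_const, Nat.card_Icc,
    ← Finset.mul_sum]
  simp only [add_tsub_cancel_right, nsmul_eq_mul]
  have h1 : 6 * Real.sqrt P * ∑ μ ∈ Finset.Icc 1 P, (μ : ℝ) ^ (-(1 / 2 : ℝ)) ≤ 12 * P := by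
    calc 6 * Real.sqrt P * ∑ μ ∈ Finset.Icc 1 P, (μ : ℝ) ^ (-(1 / 2 : ℝ))
        ≤ 6 * Real.sqrt P * (2 * Real.sqrt P) :=
          mul_le_mul_of_nonneg_left (sum_Icc_rpow_neg_half_le P) (by positivity)
      _ = 12 * P := by
          rw [show 6 * Real.sqrt P * (2 * Real.sqrt P) = 12 * (Real.sqrt P * Real.sqrt P) by ring,
            Real.mul_self_sqrt hP0.le]
  have h2 : (P : ℝ) * (3 * B / Real.sqrt K) = 3 * B * P / Real.sqrt K := by ring
  have h3 : 10 * Real.sqrt K * (2 + Real.log P + Real.log ⌈K⌉₊) * ∑ μ ∈ Finset.Icc 1 P, (1 : ℝ) / μ ≤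
      10 * Real.sqrt K * (1 + Real.log P) * (2 + Real.log P + Real.log ⌈K⌉₊) := by
    have hh := Literature.NumberTheory.Sieve.sum_Icc_one_div_le_one_add_log P
    have : 0 ≤ 10 * Real.sqrt K * (2 + Real.log P + Real.log ⌈K⌉₊) := by positivity
    calc 10 * Real.sqrt K * (2 + Real.log P + Real.log ⌈K⌉₊) * ∑ μ ∈ Finset.Icc 1 P, (1 : ℝ) / μ
        ≤ 10 * Real.sqrt K * (2 + Real.log P + Real.log ⌈K⌉₊) * (1 + Real.log P) :=
          mul_le_mul_of_nonneg_left hh this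
      _ = _ := by ring
  rw [h2]
  linarith

/-- `P ≤ K = T n/(2πm)` when `P² ≤ T/2π`, `m ≤ P`, `n ≥ 1`. [folklore] -/
theorem lemma922_P_le_K {T : ℝ} {P m n : ℕ} (hT : 0 < T) (hP : 1 ≤ P) (hPT : (P : ℝ) ^ 2 ≤ T / (2 * π))
    (hm : 1 ≤ m) (hn : 1 ≤ n) (hmP : (m : ℝ) ≤ P) : (P : ℝ) ≤ T * n / (2 * π * m) := by
  have hP0 : (0 : ℝ) < P := by exact_mod_cast hP
  have hmR : (0 : ℝ) < m := by exact_mod_cast hm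
  have hnR : (1 : ℝ) ≤ n := by exact_mod_cast hn
  have h2π : (0 : ℝ) < 2 * π := by positivity
  rw [le_div_iff₀ (by positivity)]
  have h1 : 2 * π * (P : ℝ) ^ 2 ≤ T := by rw [le_div_iff₀ h2π] at hPT; linarith
  have h2 : (P : ℝ) * (2 * π * m) ≤ 2 * π * P ^ 2 := by
    have := mul_le_mul_of_nonneg_left hmP (by positivity : 0 ≤ 2 * π * (P : ℝ))
    nlinarith
  have h3 : T ≤ T * n := le_mul_of_one_le_right hT.le hnR
  linarith

/-- `(n/(2πm))^{1/2} ≤ X^{1/2}/2` for `n ≤ X`, `m ≥ 1`. [folklore] -/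
theorem lemma922_sqrt_ratio_le {X : ℝ} {m n : ℕ} (hm : 1 ≤ m) (hnX : (n : ℝ) ≤ X) :
    Real.sqrt (n / (2 * π * m)) ≤ Real.sqrt X / 2 := by
  have hmR : (1 : ℝ) ≤ m := by exact_mod_cast hm
  have h4 : (4 : ℝ) ≤ 2 * π := by linarith [Real.pi_gt_three]
  have hn0 : (0 : ℝ) ≤ n := Nat.cast_nonneg n
  have hle : (n : ℝ) / (2 * π * m) ≤ X / 4 := by
    rw [div_le_div_iff₀ (by positivity) (by norm_num)]
    have h1 : (n : ℝ) * 4 ≤ X * 4 := by nlinarith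
    have h2 : X * 4 ≤ X * (2 * π * m) := by
      have hX : 0 ≤ X := hn0.trans hnX
      have : (4 : ℝ) ≤ 2 * π * m := by nlinarith
      exact mul_le_mul_of_nonneg_left this hX
    linarith
  calc Real.sqrt (n / (2 * π * m)) ≤ Real.sqrt (X / 4) := Real.sqrt_le_sqrt hle
    _ = Real.sqrt X / 2 := by
        rw [Real.sqrt_div' X (by norm_num), show (4:ℝ) = 2 ^ 2 by norm_num, Real.sqrt_sq (by norm_num)]

/-- `1 ≤ (2π)^{1/2} X^{1/2} (n/(2πm))^{1/2}` for `m ≤ X`, `n ≥ 1`. [folklore] -/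
theorem lemma922_one_le_sqrt_mul {X : ℝ} {m n : ℕ} (hm : 1 ≤ m) (hn : 1 ≤ n) (hmX : (m : ℝ) ≤ X) :
    1 ≤ Real.sqrt (2 * π) * Real.sqrt X * Real.sqrt (n / (2 * π * m)) := by
  have hmR : (0 : ℝ) < m := by exact_mod_cast hm
  have hnR : (1 : ℝ) ≤ n := by exact_mod_cast hn
  have hX : 0 ≤ X := hmR.le.trans hmX
  rw [← Real.sqrt_mul (by positivity), ← Real.sqrt_mul (by positivity)]
  refine Real.le_sqrt_of_sq_le ?_
  rw [one_pow]
  have : 2 * π * X * ((n : ℝ) / (2 * π * m)) = X * n / m := by field_simp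
  rw [this, le_div_iff₀ hmR]
  nlinarith

/-- The `μ`-sum bound with the parameters of Lemma 9.22 plugged in: for `K ≤ Kx ≤ K'`,
`K = Tn/(2πm)`, `K' = T₂ n/(2πm)`, `B = T₂^{1/2}`, `4 ≤ T ≤ T₂ ≤ 2T`, `1 ≤ m, n ≤ X ≤ P`, `P² ≤ T/2π`:
`∑_{μ ≤ P} μ^{-1/2}(6√P + 3B(Kx/μ)^{-1/2} + 10 (Kx/μ)^{1/2}(2 + log P + log⌈Kx/μ⌉))`
`  ≤ 12P + 11 X^{1/2} P + 8 (TX)^{1/2} (1 + log P)(2 + log P + log(3TX))`. [folklore] -/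
theorem lemma922_mu_sum_le {T T₂ X Kx : ℝ} {P m n : ℕ} (hT : 4 ≤ T) (hTT₂ : T ≤ T₂) (hT₂ : T₂ ≤ 2 * T)
    (hP : 1 ≤ P) (hPT : (P : ℝ) ^ 2 ≤ T / (2 * π)) (hm : 1 ≤ m) (hn : 1 ≤ n) (hmX : (m : ℝ) ≤ X)
    (hnX : (n : ℝ) ≤ X) (hXP : X ≤ P) (hKKx : T * n / (2 * π * m) ≤ Kx) (hKxK' : Kx ≤ T₂ * n / (2 * π * m)) :
    ∑ μ ∈ Finset.Icc 1 P, (μ : ℝ) ^ (-(1 / 2 : ℝ)) * (6 * Real.sqrt P + 3 * Real.sqrt T₂ / Real.sqrt (Kx / μ)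
          + 10 * Real.sqrt (Kx / μ) * (2 + Real.log P + Real.log ⌈Kx / μ⌉₊)) ≤
      12 * P + 11 * Real.sqrt X * P
        + 8 * Real.sqrt (T * X) * (1 + Real.log P) * (2 + Real.log P + Real.log (3 * T * X)) := by
  have hT0 : 0 < T := by linarith
  have hT₂0 : 0 < T₂ := by linarith
  have hP0 : (0 : ℝ) < P := by exact_mod_cast hP
  have hmR : (0 : ℝ) < m := by exact_mod_cast hm
  have hnR : (0 : ℝ) < n := by exact_mod_cast hn
  have hX1 : 1 ≤ X := le_trans (by exact_mod_cast hm) hmX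
  set K : ℝ := T * n / (2 * π * m) with hK
  set K' : ℝ := T₂ * n / (2 * π * m) with hK'
  set B : ℝ := Real.sqrt T₂ with hB
  have hK0 : 0 < K := by positivity
  have hKP : (P : ℝ) ≤ K := lemma922_P_le_K hT0 hP hPT hm hn (hmX.trans hXP)
  have hKx0 : 0 < Kx := hK0.trans_le hKKx
  have hPKx : (P : ℝ) ≤ Kx := hKP.trans hKKx
  have h := weighted_mu_sum_le hP B hPKx
  refine h.trans ?_
  have hsKx0 : 0 < Real.sqrt Kx := Real.sqrt_pos.2 hKx0
  have hsK0 : 0 < Real.sqrt K := Real.sqrt_pos.2 hK0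
  set ρ : ℝ := Real.sqrt (n / (2 * π * m)) with hρ
  have hρ0 : 0 < ρ := Real.sqrt_pos.2 (by positivity)
  have hsK : Real.sqrt K = Real.sqrt T * ρ := by
    rw [hK, show T * n / (2 * π * m) = T * (n / (2 * π * m)) by ring, Real.sqrt_mul hT0.le]
  have hsK' : Real.sqrt K' = Real.sqrt T₂ * ρ := by
    rw [hK', show T₂ * n / (2 * π * m) = T₂ * (n / (2 * π * m)) by ring, Real.sqrt_mul hT₂0.le]
  have hsq2T : Real.sqrt (2 * T) = Real.sqrt 2 * Real.sqrt T := Real.sqrt_mul (by norm_num) T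
  have hBT : B ≤ Real.sqrt 2 * Real.sqrt T := by rw [hB, ← hsq2T]; exact Real.sqrt_le_sqrt hT₂
  have hρX : ρ ≤ Real.sqrt X / 2 := lemma922_sqrt_ratio_le hm hnX
  have hone : 1 ≤ Real.sqrt (2 * π) * Real.sqrt X * ρ := lemma922_one_le_sqrt_mul hm hn hmX
  have hsT : 0 ≤ Real.sqrt T := Real.sqrt_nonneg T
  have hsX : 0 ≤ Real.sqrt X := Real.sqrt_nonneg X
  -- (i) `3BP/√Kx ≤ 11 √X P`
  have h1 : 3 * B * P / Real.sqrt Kx ≤ 11 * Real.sqrt X * P := by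
    have hle1 : 3 * B * P / Real.sqrt Kx ≤ 3 * B * P / Real.sqrt K :=
      div_le_div_of_nonneg_left (by positivity) hsK0 (Real.sqrt_le_sqrt hKKx)
    refine hle1.trans ?_
    rw [div_le_iff₀ hsK0, hsK]
    have h2π' : Real.sqrt 2 * Real.sqrt (2 * π) ≤ 11 / 3 := by
      rw [← Real.sqrt_mul (by norm_num)]
      refine (Real.sqrt_le_sqrt (show (2 : ℝ) * (2 * π) ≤ 13 by nlinarith [Real.pi_lt_d2])).trans ?_
      rw [Real.sqrt_le_left (by norm_num)]
      norm_num
    calc 3 * B * P ≤ 3 * (Real.sqrt 2 * Real.sqrt T) * P := by gcongr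
      _ = 3 * Real.sqrt 2 * Real.sqrt T * P * 1 := by ring
      _ ≤ 3 * Real.sqrt 2 * Real.sqrt T * P * (Real.sqrt (2 * π) * Real.sqrt X * ρ) :=
        mul_le_mul_of_nonneg_left hone (by positivity)
      _ = (3 * (Real.sqrt 2 * Real.sqrt (2 * π))) * Real.sqrt X * P * (Real.sqrt T * ρ) := by ring
      _ ≤ (3 * (11 / 3)) * Real.sqrt X * P * (Real.sqrt T * ρ) := by gcongr
      _ = 11 * Real.sqrt X * P * (Real.sqrt T * ρ) := by ring
  -- (ii) the logarithmic term
  have h2 : 10 * Real.sqrt Kx * (1 + Real.log P) * (2 + Real.log P + Real.log ⌈Kx⌉₊) ≤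
      8 * Real.sqrt (T * X) * (1 + Real.log P) * (2 + Real.log P + Real.log (3 * T * X)) := by
    have hlogP : 0 ≤ Real.log (P : ℝ) := Real.log_natCast_nonneg P
    have hsKx : Real.sqrt Kx ≤ 4 / 5 * Real.sqrt (T * X) := by
      refine (Real.sqrt_le_sqrt hKxK').trans ?_
      rw [hsK', Real.sqrt_mul hT0.le]
      have hs2 : Real.sqrt 2 ≤ 3 / 2 := by
        rw [Real.sqrt_le_left (by norm_num)]; norm_num
      calc Real.sqrt T₂ * ρ ≤ (Real.sqrt 2 * Real.sqrt T) * (Real.sqrt X / 2) :=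
            mul_le_mul hBT hρX hρ0.le (by positivity)
        _ ≤ (3 / 2 * Real.sqrt T) * (Real.sqrt X / 2) := by gcongr
        _ = 3 / 4 * (Real.sqrt T * Real.sqrt X) := by ring
        _ ≤ 4 / 5 * (Real.sqrt T * Real.sqrt X) := by
            have : 0 ≤ Real.sqrt T * Real.sqrt X := by positivity
            nlinarith
    have hceil1 : (1 : ℝ) ≤ ⌈Kx⌉₊ := by exact_mod_cast Nat.one_le_ceil_iff.2 hKx0
    have hKxTX : Kx ≤ T * X := by
      refine hKxK'.trans ?_
      rw [div_le_iff₀ (by positivity)]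
      have h1m : (1 : ℝ) ≤ m := by exact_mod_cast hm
      have hπ3 : (3 : ℝ) < π := Real.pi_gt_three
      have hTX0 : 0 ≤ T * X := by positivity
      have ha : T₂ * (n : ℝ) ≤ 2 * T * X :=
        mul_le_mul hT₂ hnX (Nat.cast_nonneg n) (by positivity)
      have h2le : (2 : ℝ) ≤ 2 * π * m := by
        have : (2 : ℝ) * 3 * 1 ≤ 2 * π * m :=
          mul_le_mul (by linarith) h1m zero_le_one (by positivity)
        linarith
      have hb : 2 * (T * X) ≤ 2 * π * m * (T * X) := mul_le_mul_of_nonneg_right h2le hTX0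
      linarith
    have hTX4 : 4 ≤ T * X := by
      have := mul_le_mul hT hX1 zero_le_one (by linarith)
      linarith
    have hlogceil : Real.log ⌈Kx⌉₊ ≤ Real.log (3 * T * X) := by
      refine Real.log_le_log (by linarith) ?_
      have : (⌈Kx⌉₊ : ℝ) < Kx + 1 := Nat.ceil_lt_add_one hKx0.le
      linarith
    have hfac1 : 0 ≤ 1 + Real.log (P : ℝ) := by linarith
    have hfac2 : 0 ≤ 2 + Real.log (P : ℝ) + Real.log ⌈Kx⌉₊ := by
      have : 0 ≤ Real.log (⌈Kx⌉₊ : ℝ) := Real.log_nonneg hceil1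
      linarith
    calc 10 * Real.sqrt Kx * (1 + Real.log P) * (2 + Real.log P + Real.log ⌈Kx⌉₊)
        ≤ 10 * (4 / 5 * Real.sqrt (T * X)) * (1 + Real.log P) * (2 + Real.log P + Real.log (3 * T * X)) := by
          refine mul_le_mul (mul_le_mul_of_nonneg_right (by linarith [hsKx]) hfac1) (by linarith) hfac2
            (by positivity)
      _ = 8 * Real.sqrt (T * X) * (1 + Real.log P) * (2 + Real.log P + Real.log (3 * T * X)) := by ring
  linarith

/-- **The error terms of (9.22.2) summed over `μ, ν ≤ P`** (Titchmarsh §9.22: "The term `O(T^{2/5})`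
gives … `O(T^{9/10})`", "… = `O(T^{1/2+ε})`. A similar argument applies in the other cases"):
for `4 ≤ T ≤ T₂ ≤ 2T`, `P ≥ 1` with `P² ≤ T/2π`, `1 ≤ m, n ≤ X ≤ P`,
`‖∑∑_{μ,ν ≤ P} (μν)^{-1/2} (∫_T^{T₂} e^{i t log(t/(e c))} dt − [T ≤ c ≤ T₂] 𝔣 e^{-ic} c^{1/2})‖`
`  ≤ 160 T^{2/5} P + 480 P + 440 X^{1/2} P + 320 (TX)^{1/2} (1 + log P)(2 + log P + log(3TX))`,
`c = 2πμνm/n`. [cite: Titchmarsh1986, §9.22] -/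
theorem lemma922_error_le {T T₂ X : ℝ} {P m n : ℕ} (hT : 4 ≤ T) (hTT₂ : T ≤ T₂) (hT₂ : T₂ ≤ 2 * T)
    (hP : 1 ≤ P) (hPT : (P : ℝ) ^ 2 ≤ T / (2 * π)) (hm : 1 ≤ m) (hn : 1 ≤ n) (hmX : (m : ℝ) ≤ X)
    (hnX : (n : ℝ) ≤ X) (hXP : X ≤ P) :
    ‖∑ μ ∈ Finset.Icc 1 P, ∑ ν ∈ Finset.Icc 1 P, ((((μ : ℝ) * ν) ^ (-(1 / 2 : ℝ)) : ℝ) : ℂ) *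
        ((∫ t in T..T₂, cexp (I * ((t * Real.log (t / (Real.exp 1 * (2 * π * μ * ν * m / n))) : ℝ) : ℂ)))
          - (if T ≤ 2 * π * μ * ν * m / n ∧ 2 * π * μ * ν * m / n ≤ T₂ then
              Literature.Analysis.Fourier.fresnelC * cexp (-I * (2 * π * μ * ν * m / n : ℝ))
                * (Real.sqrt (2 * π * μ * ν * m / n) : ℂ)
             else 0))‖ ≤
      160 * T ^ (2 / 5 : ℝ) * P + 480 * P + 440 * Real.sqrt X * P
        + 320 * Real.sqrt (T * X) * (1 + Real.log P) * (2 + Real.log P + Real.log (3 * T * X)) := by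
  have hT0 : 0 < T := by linarith
  have hT₂0 : 0 < T₂ := by linarith
  have hP0 : (0 : ℝ) < P := by exact_mod_cast hP
  have hmR : (0 : ℝ) < m := by exact_mod_cast hm
  have hnR : (0 : ℝ) < n := by exact_mod_cast hn
  set B : ℝ := Real.sqrt T₂ with hB
  have hB0 : 0 < B := Real.sqrt_pos.2 hT₂0
  set K : ℝ := T * n / (2 * π * m) with hK
  set K' : ℝ := T₂ * n / (2 * π * m) with hK'
  have hKP : (P : ℝ) ≤ K := lemma922_P_le_K hT0 hP hPT hm hn (hmX.trans hXP)
  have hKK' : K ≤ K' := by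
    rw [hK, hK']; exact div_le_div_of_nonneg_right (by nlinarith) (by positivity)
  have hK'P : (P : ℝ) ≤ K' := hKP.trans hKK'
  -- the weights
  set w : ℕ → ℕ → ℝ := fun μ ν => ((μ : ℝ) * ν) ^ (-(1 / 2 : ℝ)) with hw
  have hw0 : ∀ μ ν, 0 ≤ w μ ν := fun μ ν => Real.rpow_nonneg (by positivity) _
  have hwsplit : ∀ μ ν : ℕ, w μ ν = (μ : ℝ) ^ (-(1 / 2 : ℝ)) * (ν : ℝ) ^ (-(1 / 2 : ℝ)) := fun μ ν =>
    Real.mul_rpow (Nat.cast_nonneg μ) (Nat.cast_nonneg ν)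
  -- the per-term stationary-phase bound
  set g : ℝ → ℕ → ℕ → ℝ := fun T' μ ν =>
    1 / max |Real.log (2 * π * μ * ν * m / n / T')| (Real.sqrt T₂)⁻¹ with hg
  have hterm : ∀ μ ∈ Finset.Icc 1 P, ∀ ν ∈ Finset.Icc 1 P,
      ‖((((μ : ℝ) * ν) ^ (-(1 / 2 : ℝ)) : ℝ) : ℂ) *
        ((∫ t in T..T₂, cexp (I * ((t * Real.log (t / (Real.exp 1 * (2 * π * μ * ν * m / n))) : ℝ) : ℂ)))
          - (if T ≤ 2 * π * μ * ν * m / n ∧ 2 * π * μ * ν * m / n ≤ T₂ then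
              Literature.Analysis.Fourier.fresnelC * cexp (-I * (2 * π * μ * ν * m / n : ℝ))
                * (Real.sqrt (2 * π * μ * ν * m / n) : ℂ)
             else 0))‖ ≤
      w μ ν * (40 * T ^ (2 / 5 : ℝ) + 20 * g T μ ν + 20 * g T₂ μ ν) := by
    intro μ hμ ν hν
    have hμ0 : (0 : ℝ) < μ := by exact_mod_cast (Finset.mem_Icc.1 hμ).1
    have hν0 : (0 : ℝ) < ν := by exact_mod_cast (Finset.mem_Icc.1 hν).1
    have hc : (0 : ℝ) < 2 * π * μ * ν * m / n := by positivity
    have key := norm_logPhaseIntegral_sub_indicator_main_le hT0 hTT₂ hT₂ hc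
    rw [norm_mul, Complex.norm_real, Real.norm_eq_abs, abs_of_nonneg (hw0 μ ν)]
    refine mul_le_mul_of_nonneg_left ?_ (hw0 μ ν)
    refine key.trans (le_of_eq ?_)
    simp only [hg]
    ring
  have hsum1 := (norm_sum_le _ _).trans (Finset.sum_le_sum fun μ hμ =>
    (norm_sum_le _ _).trans (Finset.sum_le_sum fun ν hν => hterm μ hμ ν hν))
  refine hsum1.trans ?_
  -- split into the three sums
  have hsplit : ∑ μ ∈ Finset.Icc 1 P, ∑ ν ∈ Finset.Icc 1 P, w μ ν * (40 * T ^ (2 / 5 : ℝ) + 20 * g T μ ν + 20 * g T₂ μ ν)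
      = 40 * T ^ (2 / 5 : ℝ) * ∑ μ ∈ Finset.Icc 1 P, ∑ ν ∈ Finset.Icc 1 P, w μ ν
        + 20 * ∑ μ ∈ Finset.Icc 1 P, ∑ ν ∈ Finset.Icc 1 P, w μ ν * g T μ ν
        + 20 * ∑ μ ∈ Finset.Icc 1 P, ∑ ν ∈ Finset.Icc 1 P, w μ ν * g T₂ μ ν := by
    rw [Finset.mul_sum, Finset.mul_sum, Finset.mul_sum, ← Finset.sum_add_distrib, ← Finset.sum_add_distrib]
    refine Finset.sum_congr rfl fun μ _ => ?_
    rw [Finset.mul_sum, Finset.mul_sum, Finset.mul_sum, ← Finset.sum_add_distrib, ← Finset.sum_add_distrib]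
    refine Finset.sum_congr rfl fun ν _ => ?_
    ring
  rw [hsplit]
  -- (A) `∑∑ w = (∑ μ^{-1/2})² ≤ 4P`
  have hA : ∑ μ ∈ Finset.Icc 1 P, ∑ ν ∈ Finset.Icc 1 P, w μ ν ≤ 4 * P := by
    have hS := sum_Icc_rpow_neg_half_le P
    have hS0 : 0 ≤ ∑ ν ∈ Finset.Icc 1 P, (ν : ℝ) ^ (-(1 / 2 : ℝ)) :=
      Finset.sum_nonneg fun ν _ => Real.rpow_nonneg (Nat.cast_nonneg ν) _
    calc ∑ μ ∈ Finset.Icc 1 P, ∑ ν ∈ Finset.Icc 1 P, w μ ν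
        = (∑ μ ∈ Finset.Icc 1 P, (μ : ℝ) ^ (-(1 / 2 : ℝ))) * ∑ ν ∈ Finset.Icc 1 P, (ν : ℝ) ^ (-(1 / 2 : ℝ)) := by
          rw [Finset.sum_mul_sum]
          exact Finset.sum_congr rfl fun μ _ => Finset.sum_congr rfl fun ν _ => hwsplit μ ν
      _ ≤ (2 * Real.sqrt P) * (2 * Real.sqrt P) := mul_le_mul hS hS hS0 (by positivity)
      _ = 4 * (Real.sqrt P * Real.sqrt P) := by ring
      _ = 4 * P := by rw [Real.mul_self_sqrt hP0.le]
  -- (B), (C): the `ν`-sums via `sum_rpow_div_max_log_le` with `ν₀ = Kx/μ`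
  have hinner : ∀ (Kx : ℝ), (P : ℝ) ≤ Kx → ∀ (T' : ℝ), 0 < T' → Kx = T' * n / (2 * π * m) →
      ∀ μ ∈ Finset.Icc 1 P, ∑ ν ∈ Finset.Icc 1 P, w μ ν * g T' μ ν ≤
        (μ : ℝ) ^ (-(1 / 2 : ℝ)) * (6 * Real.sqrt P + 3 * Real.sqrt T₂ / Real.sqrt (Kx / μ)
          + 10 * Real.sqrt (Kx / μ) * (2 + Real.log P + Real.log ⌈Kx / μ⌉₊)) := by
    intro Kx hKx T' hT' hKxdef μ hμ
    have hμ1 : (1 : ℝ) ≤ μ := by exact_mod_cast (Finset.mem_Icc.1 hμ).1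
    have hμ0 : (0 : ℝ) < μ := by linarith
    have hμP : (μ : ℝ) ≤ P := by exact_mod_cast (Finset.mem_Icc.1 hμ).2
    have hν₀ : 1 ≤ Kx / μ := by
      rw [le_div_iff₀ hμ0, one_mul]; exact hμP.trans hKx
    have hsum := sum_rpow_div_max_log_le P hν₀ hB0
    have hgeq : ∀ ν ∈ Finset.Icc 1 P, w μ ν * g T' μ ν =
        (μ : ℝ) ^ (-(1 / 2 : ℝ)) * ((ν : ℝ) ^ (-(1 / 2 : ℝ)) / max |Real.log (ν / (Kx / μ))| B⁻¹) := by
      intro ν hν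
      have hν0 : (0 : ℝ) < ν := by exact_mod_cast (Finset.mem_Icc.1 hν).1
      rw [hwsplit]
      simp only [hg, hB]
      have : 2 * π * (μ : ℝ) * ν * m / n / T' = ν / (Kx / μ) := by
        rw [hKxdef]; field_simp
      rw [this]
      ring
    rw [Finset.sum_congr rfl hgeq, ← Finset.mul_sum]
    exact mul_le_mul_of_nonneg_left hsum (Real.rpow_nonneg hμ0.le _)
  have hBsum : ∑ μ ∈ Finset.Icc 1 P, ∑ ν ∈ Finset.Icc 1 P, w μ ν * g T μ ν ≤
      12 * P + 11 * Real.sqrt X * P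
        + 8 * Real.sqrt (T * X) * (1 + Real.log P) * (2 + Real.log P + Real.log (3 * T * X)) :=
    (Finset.sum_le_sum (hinner K hKP T hT0 rfl)).trans
      (lemma922_mu_sum_le hT hTT₂ hT₂ hP hPT hm hn hmX hnX hXP le_rfl hKK')
  have hCsum : ∑ μ ∈ Finset.Icc 1 P, ∑ ν ∈ Finset.Icc 1 P, w μ ν * g T₂ μ ν ≤
      12 * P + 11 * Real.sqrt X * P
        + 8 * Real.sqrt (T * X) * (1 + Real.log P) * (2 + Real.log P + Real.log (3 * T * X)) :=
    (Finset.sum_le_sum (hinner K' hK'P T₂ hT₂0 rfl)).trans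
      (lemma922_mu_sum_le hT hTT₂ hT₂ hP hPT hm hn hmX hnX hXP hKK' le_rfl)
  have hT25 : 0 ≤ 40 * T ^ (2 / 5 : ℝ) := by positivity
  have hA' := mul_le_mul_of_nonneg_left hA hT25
  linarith

/-! ### The main terms: `e^{-iπ/4} 𝔣 (μν)^{-1/2} c^{1/2} e^{-ic} = 2π (m/n)^{1/2} e(−μνm/n)` -/

/-- `(μν)^{-1/2} (2πμνm/n)^{1/2} = (2πm/n)^{1/2}`. [folklore] -/
theorem rpow_neg_half_mul_sqrt_c {μ ν m n : ℕ} (hμ : 0 < μ) (hν : 0 < ν) :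
    ((μ : ℝ) * ν) ^ (-(1 / 2 : ℝ)) * Real.sqrt (2 * π * μ * ν * m / n) = Real.sqrt (2 * π * m / n) := by
  have hμν : (0 : ℝ) < (μ : ℝ) * ν := by positivity
  rw [Real.rpow_neg hμν.le, ← Real.sqrt_eq_rpow, show (2 * π * μ * ν * m / n : ℝ) = (μ * ν) * (2 * π * m / n) by ring,
    Real.sqrt_mul hμν.le, ← mul_assoc, inv_mul_cancel₀ (Real.sqrt_pos.2 hμν).ne', one_mul]

/-- `(2π)^{1/2} (2πm/n)^{1/2} = 2π (m/n)^{1/2}`. [folklore] -/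
theorem sqrt_two_pi_mul_sqrt (m n : ℕ) :
    Real.sqrt (2 * π) * Real.sqrt (2 * π * m / n) = 2 * π * Real.sqrt (m / n) := by
  rw [show (2 * π * m / n : ℝ) = (2 * π) * (m / n) by ring,
    Real.sqrt_mul' (2 * π) (by positivity : (0 : ℝ) ≤ m / n), ← mul_assoc,
    Real.mul_self_sqrt (by positivity)]

/-- **The main term of one stationary point**: `e^{-iπ/4} (μν)^{-1/2} 𝔣 e^{-ic} c^{1/2} = 2π(m/n)^{1/2} e(−μmν/n)`
with `c = 2πμνm/n` (`𝔣 e^{-iπ/4} = (2π)^{1/2}`, `Literature.Analysis.Fourier.cexp_neg_mul_fresnelC`).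
[cite: Titchmarsh1986, §9.22 eq. (9.22.3)] -/
theorem lemma922_mainTerm_eq {μ ν m n : ℕ} (hμ : 0 < μ) (hν : 0 < ν) :
    cexp (-(I * (π / 4 : ℝ))) * (((((μ : ℝ) * ν) ^ (-(1 / 2 : ℝ)) : ℝ) : ℂ) *
      (Literature.Analysis.Fourier.fresnelC * cexp (-I * (2 * π * μ * ν * m / n : ℝ))
        * (Real.sqrt (2 * π * μ * ν * m / n) : ℂ))) =
      (2 * π * Real.sqrt (m / n) : ℝ) * cexp (-(2 * π * I * ((μ * m : ℕ) : ℂ) / n) * ν) := by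
  have hF : cexp (-(I * (π / 4 : ℝ))) * Literature.Analysis.Fourier.fresnelC = (Real.sqrt (2 * π) : ℂ) := by
    rw [show -(I * ((π / 4 : ℝ) : ℂ)) = -((π / 4 : ℝ) : ℂ) * I by ring]
    exact Literature.Analysis.Fourier.cexp_neg_mul_fresnelC
  have hphase : cexp (-I * (2 * π * μ * ν * m / n : ℝ)) = cexp (-(2 * π * I * ((μ * m : ℕ) : ℂ) / n) * ν) := by
    congr 1; push_cast; ring
  have hreal : (((((μ : ℝ) * ν) ^ (-(1 / 2 : ℝ)) : ℝ) : ℂ)) * (Real.sqrt (2 * π * μ * ν * m / n) : ℂ)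
      = (Real.sqrt (2 * π * m / n) : ℂ) := by
    rw [← Complex.ofReal_mul, rpow_neg_half_mul_sqrt_c hμ hν]
  calc cexp (-(I * (π / 4 : ℝ))) * (((((μ : ℝ) * ν) ^ (-(1 / 2 : ℝ)) : ℝ) : ℂ) *
        (Literature.Analysis.Fourier.fresnelC * cexp (-I * (2 * π * μ * ν * m / n : ℝ))
          * (Real.sqrt (2 * π * μ * ν * m / n) : ℂ)))
      = (cexp (-(I * (π / 4 : ℝ))) * Literature.Analysis.Fourier.fresnelC) *
          ((((((μ : ℝ) * ν) ^ (-(1 / 2 : ℝ)) : ℝ) : ℂ)) * (Real.sqrt (2 * π * μ * ν * m / n) : ℂ)) *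
          cexp (-I * (2 * π * μ * ν * m / n : ℝ)) := by ring
    _ = (Real.sqrt (2 * π) : ℂ) * (Real.sqrt (2 * π * m / n) : ℂ) *
          cexp (-(2 * π * I * ((μ * m : ℕ) : ℂ) / n) * ν) := by rw [hF, hreal, hphase]
    _ = _ := by rw [← Complex.ofReal_mul, sqrt_two_pi_mul_sqrt]

/-- The stationary-point condition `T ≤ 2πμνm/n ≤ T₂` as a range of `ν`: for `μ, m, n ≥ 1`, `T₂ ≥ 0`,
`∑_{ν ≤ P} [T ≤ c ≤ T₂] f(ν) = ∑_{⌈α⌉ ≤ ν ≤ min(P, ⌊β⌋)} f(ν)` with `α = Tn/(2πmμ)`, `β = T₂n/(2πmμ)`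
(and `⌈α⌉ ≥ 1` automatically when `α > 0`). [folklore] -/
theorem sum_Icc_ite_stationary_eq {T T₂ : ℝ} (hT : 0 < T) (hT₂ : 0 ≤ T₂) {μ m n : ℕ} (hμ : 0 < μ)
    (hm : 0 < m) (hn : 0 < n) (P : ℕ) (f : ℕ → ℂ) :
    ∑ ν ∈ Finset.Icc 1 P, (if T ≤ 2 * π * μ * ν * m / n ∧ 2 * π * μ * ν * m / n ≤ T₂ then f ν else 0) =
      ∑ ν ∈ Finset.Icc ⌈T * n / (2 * π * m * μ)⌉₊ (min P ⌊T₂ * n / (2 * π * m * μ)⌋₊), f ν := by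
  have hμR : (0 : ℝ) < μ := by exact_mod_cast hμ
  have hmR : (0 : ℝ) < m := by exact_mod_cast hm
  have hnR : (0 : ℝ) < n := by exact_mod_cast hn
  have hd : (0 : ℝ) < 2 * π * m * μ := by positivity
  set α : ℝ := T * n / (2 * π * m * μ) with hα
  set β : ℝ := T₂ * n / (2 * π * m * μ) with hβ
  have hα0 : 0 < α := by positivity
  have hβ0 : 0 ≤ β := by positivity
  have hcond : ∀ ν : ℕ, (T ≤ 2 * π * μ * ν * m / n ∧ 2 * π * μ * ν * m / n ≤ T₂) ↔ (α ≤ ν ∧ (ν : ℝ) ≤ β) := by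
    intro ν
    have e : 2 * π * (μ : ℝ) * ν * m / n = (ν : ℝ) * (2 * π * m * μ) / n := by ring
    rw [e, hα, hβ, div_le_iff₀ hd, le_div_iff₀ hnR, div_le_iff₀ hnR, le_div_iff₀ hd]
  rw [← Finset.sum_filter]
  congr 1
  ext ν
  simp only [Finset.mem_filter, Finset.mem_Icc, hcond, Nat.ceil_le, le_min_iff]
  constructor
  · rintro ⟨⟨h1, h2⟩, h3, h4⟩
    exact ⟨h3, h2, (Nat.le_floor_iff hβ0).2 h4⟩
  · rintro ⟨h3, h2, h4⟩
    have h1 : 1 ≤ ν := by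
      have : (0 : ℝ) < ν := hα0.trans_le h3
      exact_mod_cast Nat.one_le_iff_ne_zero.2 (by rintro rfl; simp at this)
    exact ⟨⟨h1, h2⟩, h3, (Nat.le_floor_iff hβ0).1 h4⟩

/-- The inner sums: `‖∑_{a ≤ ν ≤ b} e(−μmν/n)‖ ≤ n/2` for `n ∤ μ` (with `(m,n) = 1`), and `= b + 1 − a`
(the number of terms) for `n ∣ μ`. [cite: Titchmarsh1986, §9.22] -/
theorem lemma922_inner_sum {μ m n : ℕ} (hn : 0 < n) (hcop : Nat.Coprime m n) (a b : ℕ) :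
    (¬ n ∣ μ → ‖∑ ν ∈ Finset.Icc a b, cexp (-(2 * π * I * ((μ * m : ℕ) : ℂ) / n) * ν)‖ ≤ (n : ℝ) / 2) ∧
    (n ∣ μ → ∑ ν ∈ Finset.Icc a b, cexp (-(2 * π * I * ((μ * m : ℕ) : ℂ) / n) * ν) = ((b + 1 - a : ℕ) : ℂ)) := by
  constructor
  · intro hnd
    have hk : ¬ n ∣ μ * m := fun h => hnd ((Nat.Coprime.dvd_mul_right hcop.symm).1 h)
    exact norm_sum_cexp_rational_le hn hk a b
  · intro hd
    have hk : n ∣ μ * m := dvd_mul_of_dvd_left hd m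
    rw [Finset.sum_congr rfl fun ν _ => cexp_rational_eq_one hn hk ν, Finset.sum_const, Nat.card_Icc,
      nsmul_eq_mul, mul_one]

/-! ### Summing the main terms over `μ`: divisibility by `n` and the count of stationary points -/

/-- Multiples of `n` in `[1, P]` are `n r`, `r ∈ [1, P/n]`. [folklore] -/
theorem sum_Icc_filter_dvd_eq_sum {n : ℕ} (hn : 0 < n) (P : ℕ) (F : ℕ → ℂ) :
    ∑ μ ∈ (Finset.Icc 1 P).filter (n ∣ ·), F μ = ∑ r ∈ Finset.Icc 1 (P / n), F (n * r) := by
  have hinj : Set.InjOn (fun r => n * r) (Finset.Icc 1 (P / n) : Finset ℕ) :=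
    fun a _ b _ h => Nat.eq_of_mul_eq_mul_left hn h
  rw [← Finset.sum_image hinj]
  congr 1
  ext μ
  simp only [Finset.mem_filter, Finset.mem_Icc, Finset.mem_image]
  constructor
  · rintro ⟨⟨h1, h2⟩, ⟨r, rfl⟩⟩
    refine ⟨r, ⟨?_, ?_⟩, rfl⟩
    · rcases Nat.eq_zero_or_pos r with rfl | hr
      · simp at h1
      · exact hr
    · exact (Nat.le_div_iff_mul_le hn).2 (by rw [mul_comm]; exact h2)
  · rintro ⟨r, ⟨h1, h2⟩, rfl⟩
    refine ⟨⟨Nat.mul_pos hn h1, ?_⟩, dvd_mul_right n r⟩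
    calc n * r ≤ n * (P / n) := Nat.mul_le_mul_left n h2
      _ ≤ P := Nat.mul_div_le P n

/-- **Splitting the `μ`-sum by `n ∣ μ`**: with `a_μ = ⌈Tn/(2πmμ)⌉`, `b_μ = min(P, ⌊T₂n/(2πmμ)⌋)`,
`∑_{μ ≤ P} ∑_{a_μ ≤ ν ≤ b_μ} e(−μmν/n) = ∑_{r ≤ P/n} #[a_{nr}, b_{nr}] + G`, `‖G‖ ≤ P n/2`
(Titchmarsh §9.22: "The error term `O(n)` contributes `O{(mn)^{1/2} τ}`"). [cite: Titchmarsh1986, §9.22] -/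
theorem lemma922_mu_sum_split {T T₂ : ℝ} {P m n : ℕ} (hn : 0 < n) (hcop : Nat.Coprime m n) :
    ‖(∑ μ ∈ Finset.Icc 1 P, ∑ ν ∈ Finset.Icc ⌈T * n / (2 * π * m * μ)⌉₊ (min P ⌊T₂ * n / (2 * π * m * μ)⌋₊),
        cexp (-(2 * π * I * ((μ * m : ℕ) : ℂ) / n) * ν))
      - ∑ r ∈ Finset.Icc 1 (P / n),
        ((min P ⌊T₂ * n / (2 * π * m * (n * r : ℕ))⌋₊ + 1 - ⌈T * n / (2 * π * m * (n * r : ℕ))⌉₊ : ℕ) : ℂ)‖ ≤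
      (P : ℝ) * n / 2 := by
  set inner : ℕ → ℂ := fun μ => ∑ ν ∈ Finset.Icc ⌈T * n / (2 * π * m * μ)⌉₊ (min P ⌊T₂ * n / (2 * π * m * μ)⌋₊),
    cexp (-(2 * π * I * ((μ * m : ℕ) : ℂ) / n) * ν) with hinner
  have hsplit := (Finset.sum_filter_add_sum_filter_not (Finset.Icc 1 P) (n ∣ ·) inner)
  -- the divisible part is the count
  have hdiv : ∑ μ ∈ (Finset.Icc 1 P).filter (n ∣ ·), inner μ = ∑ r ∈ Finset.Icc 1 (P / n),
      ((min P ⌊T₂ * n / (2 * π * m * (n * r : ℕ))⌋₊ + 1 - ⌈T * n / (2 * π * m * (n * r : ℕ))⌉₊ : ℕ) : ℂ) := by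
    rw [sum_Icc_filter_dvd_eq_sum hn]
    refine Finset.sum_congr rfl fun r _ => ?_
    exact (lemma922_inner_sum (μ := n * r) hn hcop _ _).2 (dvd_mul_right n r)
  rw [← hsplit, hdiv, add_sub_cancel_left]
  calc ‖∑ μ ∈ (Finset.Icc 1 P).filter (fun μ => ¬ n ∣ μ), inner μ‖
      ≤ ∑ μ ∈ (Finset.Icc 1 P).filter (fun μ => ¬ n ∣ μ), ‖inner μ‖ := norm_sum_le _ _
    _ ≤ ∑ μ ∈ (Finset.Icc 1 P).filter (fun μ => ¬ n ∣ μ), (n : ℝ) / 2 :=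
        Finset.sum_le_sum fun μ hμ => (lemma922_inner_sum hn hcop _ _).1 (Finset.mem_filter.1 hμ).2
    _ ≤ ∑ μ ∈ Finset.Icc 1 P, (n : ℝ) / 2 :=
        Finset.sum_le_sum_of_subset_of_nonneg (Finset.filter_subset _ _) fun _ _ _ => by positivity
    _ = (P : ℝ) * n / 2 := by rw [Finset.sum_const, Nat.card_Icc, nsmul_eq_mul]; push_cast; ring

/-- **The number of stationary points is the length of their interval, up to `1`**: for `α ≥ 1`,
`β ≥ 0`, `|#{ν ∈ [1,P] : α ≤ ν ≤ β} − max(0, min(P, β) − α)| ≤ 1`, with the count written as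
`min(P,⌊β⌋) + 1 − ⌈α⌉`. [folklore] -/
theorem abs_count_sub_length_le_one {α β : ℝ} (hα : 1 ≤ α) (hβ : 0 ≤ β) (P : ℕ) :
    |(((min P ⌊β⌋₊ + 1 - ⌈α⌉₊ : ℕ) : ℕ) : ℝ) - max 0 (min (P : ℝ) β - α)| ≤ 1 := by
  set a := ⌈α⌉₊ with ha
  set b := min P ⌊β⌋₊ with hb
  have ha1 : (a : ℝ) - 1 < α := by
    have := Nat.ceil_lt_add_one (by linarith : 0 ≤ α); rw [← ha] at this; linarith
  have ha2 : α ≤ a := Nat.le_ceil α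
  have hb1 : (b : ℝ) ≤ min (P : ℝ) β := by
    rw [hb]; rcases le_total P ⌊β⌋₊ with h | h
    · rw [min_eq_left h]
      refine le_min le_rfl ?_
      have : (⌊β⌋₊ : ℝ) ≤ β := Nat.floor_le hβ
      have : (P : ℝ) ≤ ⌊β⌋₊ := by exact_mod_cast h
      linarith
    · rw [min_eq_right h]
      refine le_min (by exact_mod_cast h) (Nat.floor_le hβ)
  have hb2 : min (P : ℝ) β < b + 1 := by
    rw [hb]; rcases le_total P ⌊β⌋₊ with h | h
    · rw [min_eq_left h]; have := min_le_left (P : ℝ) β; linarith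
    · rw [min_eq_right h]
      have : β < ⌊β⌋₊ + 1 := Nat.lt_floor_add_one β
      have := min_le_right (P : ℝ) β; linarith
  -- case analysis on `a ≤ b + 1`
  rcases le_or_gt a (b + 1) with hab | hab
  · have hcast : (((b + 1 - a : ℕ) : ℕ) : ℝ) = (b : ℝ) + 1 - a := by
      rw [Nat.cast_sub hab]; push_cast; ring
    rw [hcast, abs_le]
    constructor
    · -- `max 0 L ≤ (b+1−a) + 1`
      have : max 0 (min (P : ℝ) β - α) ≤ (b : ℝ) + 1 - a + 1 := by
        refine max_le ?_ (by linarith)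
        have : (a : ℝ) ≤ b + 1 := by exact_mod_cast hab
        linarith
      linarith
    · have : (b : ℝ) + 1 - a - 1 ≤ max 0 (min (P : ℝ) β - α) :=
        le_max_of_le_right (by linarith)
      linarith
  · have hzero : (b + 1 - a : ℕ) = 0 := Nat.sub_eq_zero_of_le hab.le
    rw [hzero, Nat.cast_zero, zero_sub, abs_neg]
    have hlt : min (P : ℝ) β - α < 1 := by
      have : ((b + 1 : ℕ) : ℝ) < a := by exact_mod_cast hab
      push_cast at this; linarith
    rw [abs_of_nonneg (le_max_left _ _)]
    exact max_le zero_le_one hlt.le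

/-- **The count of stationary points summed over `r`**: with `α_r = T/(2πmr)`, `β_r = T₂/(2πmr)`,
`U = T₂ − T`, `R = ⌊P/n⌋`, `r₀ = ⌈T/(2πmP)⌉` (so `α_r ≤ P ⟺ r ≥ r₀`),
`|∑_{r ≤ R} #{ν ≤ P : α_r ≤ ν ≤ β_r} − (U/(2πm)) ∑_{r₀ ≤ r ≤ R} 1/r| ≤ R + (U/(2πmP) + 1) · UP/T`
(Titchmarsh §9.22: "`2π (m/n)^{1/2} ∑_{τ/m ≤ r ≤ τ/n} (v₂ − v₁)`", the replacement of `v₂` by `v₃` at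
cost `O(U²T⁻¹) + O(M^{1/2} U T^{-1/2})`, and `∑ (v₃ − v₁) = (U/(mn)^{1/2}) ∑ 1/r`).
[cite: Titchmarsh1986, §9.22] -/
theorem lemma922_count_sum {T T₂ : ℝ} {P m R : ℕ} (hT : 0 < T) (hTT₂ : T ≤ T₂) (hP : 1 ≤ P)
    (hPT : (P : ℝ) ^ 2 ≤ T / (2 * π)) (hm : 1 ≤ m) (hmP : (m : ℝ) ≤ P) (hR : R ≤ P) :
    |(∑ r ∈ Finset.Icc 1 R,
        (((min P ⌊T₂ / (2 * π * m * r)⌋₊ + 1 - ⌈T / (2 * π * m * r)⌉₊ : ℕ) : ℕ) : ℝ))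
      - (T₂ - T) / (2 * π * m) * ∑ r ∈ Finset.Icc ⌈T / (2 * π * m * P)⌉₊ R, (1 : ℝ) / r| ≤
      R + ((T₂ - T) / (2 * π * m * P) + 1) * ((T₂ - T) * P / T) := by
  have hP0 : (0 : ℝ) < P := by exact_mod_cast hP
  have hmR : (0 : ℝ) < m := by exact_mod_cast hm
  have h2π : (0 : ℝ) < 2 * π := by positivity
  have hT₂0 : 0 < T₂ := hT.trans_le hTT₂
  have hU : 0 ≤ T₂ - T := by linarith
  set U := T₂ - T with hUdef
  set α : ℕ → ℝ := fun r => T / (2 * π * m * r) with hα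
  set β : ℕ → ℝ := fun r => T₂ / (2 * π * m * r) with hβ
  set ℓ : ℕ → ℝ := fun r => max 0 (min (P : ℝ) (β r) - α r) with hℓ
  set r₀ := ⌈T / (2 * π * m * P)⌉₊ with hr₀
  set r₁ := ⌈T₂ / (2 * π * m * P)⌉₊ with hr₁
  -- `T/(2πmP) ≥ 1`, hence `α r ≥ 1` for `r ≤ P`, and `r₀ ≥ 1`
  have hbase : 1 ≤ T / (2 * π * m * P) := by
    rw [le_div_iff₀ (by positivity), one_mul]
    have h1 : 2 * π * (P : ℝ) ^ 2 ≤ T := by rw [le_div_iff₀ h2π] at hPT; linarith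
    have : 2 * π * (m : ℝ) * P ≤ 2 * π * P ^ 2 := by
      have := mul_le_mul_of_nonneg_left hmP (by positivity : 0 ≤ 2 * π * (P : ℝ)); nlinarith
    linarith
  have hr₀1 : 1 ≤ r₀ := Nat.one_le_ceil_iff.2 (lt_of_lt_of_le one_pos hbase)
  have hαr : ∀ r : ℕ, 1 ≤ r → r ≤ P → 1 ≤ α r ∧ α r ≤ β r ∧ β r - α r = U / (2 * π * m * r) := by
    intro r hr1 hrP
    have hr0 : (0 : ℝ) < r := by exact_mod_cast hr1
    have hrP' : (r : ℝ) ≤ P := by exact_mod_cast hrP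
    refine ⟨?_, ?_, ?_⟩
    · simp only [hα]
      rw [le_div_iff₀ (by positivity), one_mul]
      rw [le_div_iff₀ (by positivity), one_mul] at hbase
      have : 2 * π * (m : ℝ) * r ≤ 2 * π * m * P := by
        have := mul_le_mul_of_nonneg_left hrP' (by positivity : 0 ≤ 2 * π * (m : ℝ)); linarith
      linarith
    · simp only [hα, hβ]; exact div_le_div_of_nonneg_right hTT₂ (by positivity)
    · simp only [hα, hβ, hUdef]; field_simp
  -- Step 1: counts vs lengths
  have hstep1 : |(∑ r ∈ Finset.Icc 1 R,
        (((min P ⌊T₂ / (2 * π * m * r)⌋₊ + 1 - ⌈T / (2 * π * m * r)⌉₊ : ℕ) : ℕ) : ℝ)) - ∑ r ∈ Finset.Icc 1 R, ℓ r|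
      ≤ R := by
    rw [← Finset.sum_sub_distrib]
    refine (Finset.abs_sum_le_sum_abs _ _).trans ?_
    calc ∑ r ∈ Finset.Icc 1 R, |((((min P ⌊T₂ / (2 * π * m * r)⌋₊ + 1 - ⌈T / (2 * π * m * r)⌉₊ : ℕ) : ℕ) : ℝ)) - ℓ r|
        ≤ ∑ r ∈ Finset.Icc 1 R, (1 : ℝ) := by
          refine Finset.sum_le_sum fun r hr => ?_
          have hr1 : 1 ≤ r := (Finset.mem_Icc.1 hr).1
          have hrP : r ≤ P := (Finset.mem_Icc.1 hr).2.trans hR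
          obtain ⟨hα1, -, -⟩ := hαr r hr1 hrP
          have hβ0 : 0 ≤ β r := by simp only [hβ]; positivity
          exact abs_count_sub_length_le_one hα1 hβ0 P
      _ = R := by simp
  -- Step 2: `ℓ r = 0` for `r < r₀`
  have hstep2 : ∑ r ∈ Finset.Icc 1 R, ℓ r = ∑ r ∈ Finset.Icc r₀ R, ℓ r := by
    have hzero : ∀ r ∈ Finset.Icc 1 R, r < r₀ → ℓ r = 0 := by
      intro r hr hlt
      have hr1 : 1 ≤ r := (Finset.mem_Icc.1 hr).1
      have hr0 : (0 : ℝ) < r := by exact_mod_cast hr1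
      have hlt' : (r : ℝ) < T / (2 * π * m * P) := by
        have := Nat.lt_ceil.1 (by rw [← hr₀]; exact hlt)
        exact this
      -- `α r > P`
      have hαP : (P : ℝ) < α r := by
        simp only [hα]
        rw [lt_div_iff₀ (by positivity)]
        rw [lt_div_iff₀ (by positivity)] at hlt'
        nlinarith
      simp only [hℓ]
      refine max_eq_left ?_
      have := min_le_left (P : ℝ) (β r)
      linarith
    rw [← Finset.sum_filter_of_ne (p := fun r => r₀ ≤ r) (fun r hr hne => by
      by_contra h; exact hne (hzero r hr (not_le.1 h)))]
    congr 1
    ext r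
    simp only [Finset.mem_filter, Finset.mem_Icc]
    omega
  -- Step 3: lengths vs `U/(2πmr)` on `[r₀, R]`
  have hstep3 : 0 ≤ ∑ r ∈ Finset.Icc r₀ R, (U / (2 * π * m * r) - ℓ r) ∧
      ∑ r ∈ Finset.Icc r₀ R, (U / (2 * π * m * r) - ℓ r) ≤ (U / (2 * π * m * P) + 1) * (U * P / T) := by
    have hterm : ∀ r ∈ Finset.Icc r₀ R, 0 ≤ U / (2 * π * m * r) - ℓ r ∧
        U / (2 * π * m * r) - ℓ r ≤ (if r < r₁ then U / (2 * π * m * r₀) else 0) := by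
      intro r hr
      have hrr₀ : r₀ ≤ r := (Finset.mem_Icc.1 hr).1
      have hr1 : 1 ≤ r := hr₀1.trans hrr₀
      have hrP : r ≤ P := (Finset.mem_Icc.1 hr).2.trans hR
      have hr0 : (0 : ℝ) < r := by exact_mod_cast hr1
      obtain ⟨hα1, hαβ, hdiff⟩ := hαr r hr1 hrP
      -- `α r ≤ P` since `r ≥ r₀ ≥ T/(2πmP)`
      have hαP : α r ≤ P := by
        have hge : T / (2 * π * m * P) ≤ r := (Nat.le_ceil _).trans (by exact_mod_cast hrr₀)
        simp only [hα]
        rw [div_le_iff₀ (by positivity)]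
        rw [div_le_iff₀ (by positivity)] at hge
        nlinarith
      have hℓeq : ℓ r = min (P : ℝ) (β r) - α r := by
        simp only [hℓ]; exact max_eq_right (by rw [sub_nonneg]; exact le_min hαP hαβ)
      constructor
      · rw [hℓeq, ← hdiff]; have := min_le_right (P : ℝ) (β r); linarith
      · split_ifs with hlt
        · -- `U/(2πmr) − ℓ ≤ U/(2πmr) ≤ U/(2πm r₀)`
          have hℓ0 : 0 ≤ ℓ r := by simp only [hℓ]; exact le_max_left _ _
          have hr₀R : (r₀ : ℝ) ≤ r := by exact_mod_cast hrr₀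
          have hr₀0 : (0 : ℝ) < r₀ := by exact_mod_cast hr₀1
          calc U / (2 * π * m * r) - ℓ r ≤ U / (2 * π * m * r) := by linarith
            _ ≤ U / (2 * π * m * r₀) := by
                refine div_le_div_of_nonneg_left hU (by positivity) ?_
                exact mul_le_mul_of_nonneg_left hr₀R (by positivity)
        · -- `r ≥ r₁`: `β r ≤ P`, so `ℓ r = β − α`
          have hge : T₂ / (2 * π * m * P) ≤ r := (Nat.le_ceil _).trans (by exact_mod_cast not_lt.1 hlt)
          have hβP : β r ≤ P := by
            simp only [hβ]
            rw [div_le_iff₀ (by positivity)]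
            rw [div_le_iff₀ (by positivity)] at hge
            nlinarith
          rw [hℓeq, min_eq_right hβP, hdiff]; simp
    constructor
    · exact Finset.sum_nonneg fun r hr => (hterm r hr).1
    · calc ∑ r ∈ Finset.Icc r₀ R, (U / (2 * π * m * r) - ℓ r)
          ≤ ∑ r ∈ Finset.Icc r₀ R, (if r < r₁ then U / (2 * π * m * r₀) else 0) :=
            Finset.sum_le_sum fun r hr => (hterm r hr).2
        _ = ((Finset.Icc r₀ R).filter (· < r₁)).card * (U / (2 * π * m * r₀)) := by
            rw [← Finset.sum_filter, Finset.sum_const, nsmul_eq_mul]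
        _ ≤ ((r₁ - r₀ : ℕ) : ℝ) * (U / (2 * π * m * r₀)) := by
            refine mul_le_mul_of_nonneg_right ?_ (by positivity)
            have : ((Finset.Icc r₀ R).filter (· < r₁)) ⊆ Finset.Ico r₀ r₁ := by
              intro r hr
              rw [Finset.mem_filter, Finset.mem_Icc] at hr
              rw [Finset.mem_Ico]; exact ⟨hr.1.1, hr.2⟩
            have := Finset.card_le_card this
            rw [Nat.card_Ico] at this
            exact_mod_cast this
        _ ≤ (U / (2 * π * m * P) + 1) * (U * P / T) := by
            have hr₀0 : (0 : ℝ) < r₀ := by exact_mod_cast hr₀1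
            -- `(r₁ − r₀ : ℕ) ≤ U/(2πmP) + 1`
            have hdiff : ((r₁ - r₀ : ℕ) : ℝ) ≤ U / (2 * π * m * P) + 1 := by
              rcases le_or_gt r₁ r₀ with h | h
              · rw [Nat.sub_eq_zero_of_le h]; norm_num; positivity
              · rw [Nat.cast_sub h.le]
                have h1 : (r₁ : ℝ) < T₂ / (2 * π * m * P) + 1 := Nat.ceil_lt_add_one (by positivity)
                have h0 : T / (2 * π * m * P) ≤ r₀ := Nat.le_ceil _
                have : T₂ / (2 * π * m * P) - T / (2 * π * m * P) = U / (2 * π * m * P) := by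
                  rw [hUdef]; field_simp
                linarith
            -- `U/(2πm r₀) ≤ U P/T`
            have hsecond : U / (2 * π * m * r₀) ≤ U * P / T := by
              have h0 : T / (2 * π * m * P) ≤ r₀ := Nat.le_ceil _
              rw [div_le_div_iff₀ (by positivity) hT]
              rw [div_le_iff₀ (by positivity)] at h0
              have : U * T ≤ U * (r₀ * (2 * π * m * P)) := mul_le_mul_of_nonneg_left h0 hU
              nlinarith
            exact mul_le_mul hdiff hsecond (by positivity) (by positivity)
  -- assemble: `Σ count = (U/(2πm)) Σ 1/r − D + Θ`
  have hsumUr : ∑ r ∈ Finset.Icc r₀ R, U / (2 * π * m * r) = U / (2 * π * m) * ∑ r ∈ Finset.Icc r₀ R, (1 : ℝ) / r := by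
    rw [Finset.mul_sum]
    refine Finset.sum_congr rfl fun r hr => ?_
    have hr0 : (0 : ℝ) < r := by exact_mod_cast hr₀1.trans (Finset.mem_Icc.1 hr).1
    field_simp
  obtain ⟨hD0, hD1⟩ := hstep3
  rw [Finset.sum_sub_distrib, hsumUr] at hD0 hD1
  rw [abs_le] at hstep1 ⊢
  rw [hstep2] at hstep1
  constructor <;> nlinarith [hD0, hD1, hstep1.1, hstep1.2]

/-! ### Lemma 9.22 -/

/-- `2π (m/n)^{1/2} · U/(2πm) = U/(mn)^{1/2}`. [folklore] -/
theorem two_pi_sqrt_mul_div {m n : ℕ} (hm : 0 < m) (hn : 0 < n) (U : ℝ) :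
    2 * π * Real.sqrt (m / n) * (U / (2 * π * m)) = U / Real.sqrt (m * n) := by
  have hmR : (0 : ℝ) < m := by exact_mod_cast hm
  have hnR : (0 : ℝ) < n := by exact_mod_cast hn
  have hπ : (0 : ℝ) < π := Real.pi_pos
  rw [Real.sqrt_div' _ hnR.le, Real.sqrt_mul hmR.le]
  have hsm : 0 < Real.sqrt m := Real.sqrt_pos.2 hmR
  have hsn : 0 < Real.sqrt n := Real.sqrt_pos.2 hnR
  field_simp
  rw [Real.sq_sqrt hmR.le]; ring

/-- **Titchmarsh's Lemma 9.22.** Let `4 ≤ T ≤ T₂ ≤ 2T`, `U = T₂ − T`, `P ≥ 1` with `P² ≤ T/2π`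
(`P = ⌊(T/2π)^{1/2}⌋`), `S₁(t) = ∑_{μ ≤ P} μ^{-1/2-it}`, and `1 ≤ m, n ≤ X ≤ P` coprime. Then
`‖∫_T^{T₂} e^{i(t log(t/2π) − t − π/4)} S₁(t)² (n/m)^{it} dt − (U/(mn)^{1/2}) ∑_{⌈T/(2πmP)⌉ ≤ r ≤ P/n} 1/r‖`
`  ≤ 160 T^{2/5} P + 480 P + 440 X^{1/2} P + 320 (TX)^{1/2}(1 + log P)(2 + log P + log(3TX))`
`    + 2π X^{1/2} (P + PX/2 + (U/(2πP) + 1) UP/T)`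
(the printed statement: `= (U/(mn)^{1/2}) ∑_{τ/m ≤ r ≤ τ/n} 1/r + O(M T^{1/2}) + O(U²/T) + O(T^{9/10})`,
"If `m < n`, the first term … is to be omitted" — here the sum is empty in that case up to `O(1)`
terms). [cite: Titchmarsh1986, Lemma 9.22] -/
theorem lemma922 {T T₂ X : ℝ} {P m n : ℕ} (hT : 4 ≤ T) (hTT₂ : T ≤ T₂) (hT₂ : T₂ ≤ 2 * T)
    (hP : 1 ≤ P) (hPT : (P : ℝ) ^ 2 ≤ T / (2 * π)) (hm : 1 ≤ m) (hn : 1 ≤ n) (hcop : Nat.Coprime m n)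
    (hmX : (m : ℝ) ≤ X) (hnX : (n : ℝ) ≤ X) (hXP : X ≤ P) :
    ‖(∫ t in T..T₂, cexp (I * ((t * Real.log (t / (2 * π)) - t - π / 4 : ℝ) : ℂ))
        * (∑ μ ∈ Finset.Icc 1 P, (((μ : ℝ) ^ (-(1 / 2 : ℝ)) : ℝ) : ℂ) * cexp (-(I * t * Real.log μ))) ^ 2
        * cexp (I * t * ((Real.log n - Real.log m : ℝ) : ℂ)))
      - (((T₂ - T) / Real.sqrt (m * n) * ∑ r ∈ Finset.Icc ⌈T / (2 * π * m * P)⌉₊ (P / n), (1 : ℝ) / r : ℝ) : ℂ)‖ ≤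
      160 * T ^ (2 / 5 : ℝ) * P + 480 * P + 440 * Real.sqrt X * P
        + 320 * Real.sqrt (T * X) * (1 + Real.log P) * (2 + Real.log P + Real.log (3 * T * X))
        + 2 * π * Real.sqrt X * (P + P * X / 2 + ((T₂ - T) / (2 * π * P) + 1) * ((T₂ - T) * P / T)) := by
  have hT0 : 0 < T := by linarith
  have hT₂0 : 0 < T₂ := by linarith
  have hP0 : (0 : ℝ) < P := by exact_mod_cast hP
  have hm0 : 0 < m := hm
  have hn0 : 0 < n := hn
  have hmR : (0 : ℝ) < m := by exact_mod_cast hm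
  have hnR : (0 : ℝ) < n := by exact_mod_cast hn
  have hX1 : 1 ≤ X := le_trans (by exact_mod_cast hm) hmX
  have hU : 0 ≤ T₂ - T := by linarith
  set U := T₂ - T with hUdef
  -- notation
  set w : ℕ → ℕ → ℂ := fun μ ν => ((((μ : ℝ) * ν) ^ (-(1 / 2 : ℝ)) : ℝ) : ℂ) with hw
  set Ic : ℕ → ℕ → ℂ := fun μ ν =>
    ∫ t in T..T₂, cexp (I * ((t * Real.log (t / (Real.exp 1 * (2 * π * μ * ν * m / n))) : ℝ) : ℂ)) with hIc
  set Mt : ℕ → ℕ → ℂ := fun μ ν =>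
    if T ≤ 2 * π * μ * ν * m / n ∧ 2 * π * μ * ν * m / n ≤ T₂ then
      Literature.Analysis.Fourier.fresnelC * cexp (-I * (2 * π * μ * ν * m / n : ℝ))
        * (Real.sqrt (2 * π * μ * ν * m / n) : ℂ) else 0 with hMt
  set e4 : ℂ := cexp (-(I * (π / 4 : ℝ))) with he4
  have he4n : ‖e4‖ = 1 := by
    rw [he4, show -(I * ((π / 4 : ℝ) : ℂ)) = ((-(π / 4) : ℝ) : ℂ) * I by push_cast; ring,
      Complex.norm_exp_ofReal_mul_I]
  -- (1) `J = e4 ΣΣ w Ic`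
  have hJ := lemma922_integral_eq P hm0 hn0 hT0 hTT₂
  -- (2) the error part
  have hErr := lemma922_error_le hT hTT₂ hT₂ hP hPT hm hn hmX hnX hXP
  -- (3) the main part: `e4 ΣΣ w Mt = 2π√(m/n) Σ_μ Σ_{Icc} e(μ,ν)`
  set ee : ℕ → ℕ → ℂ := fun μ ν => cexp (-(2 * π * I * ((μ * m : ℕ) : ℂ) / n) * ν) with hee
  have hMain : e4 * ∑ μ ∈ Finset.Icc 1 P, ∑ ν ∈ Finset.Icc 1 P, w μ ν * Mt μ ν =
      ((2 * π * Real.sqrt (m / n) : ℝ) : ℂ) * ∑ μ ∈ Finset.Icc 1 P,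
        ∑ ν ∈ Finset.Icc ⌈T * n / (2 * π * m * μ)⌉₊ (min P ⌊T₂ * n / (2 * π * m * μ)⌋₊), ee μ ν := by
    rw [Finset.mul_sum, Finset.mul_sum]
    refine Finset.sum_congr rfl fun μ hμ => ?_
    have hμ0 : 0 < μ := (Finset.mem_Icc.1 hμ).1
    rw [Finset.mul_sum, ← sum_Icc_ite_stationary_eq hT0 hT₂0.le hμ0 hm0 hn0 P (ee μ), Finset.mul_sum]
    refine Finset.sum_congr rfl fun ν hν => ?_
    have hν0 : 0 < ν := (Finset.mem_Icc.1 hν).1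
    simp only [hMt]
    split_ifs with hcond
    · exact lemma922_mainTerm_eq (m := m) (n := n) hμ0 hν0
    · simp
  -- (4) split of the `μ`-sum
  have hSplit := lemma922_mu_sum_split (T := T) (T₂ := T₂) (P := P) (m := m) hn0 hcop
  -- (5) the counts with `T/(2πmr)`
  have hcount_eq : ∀ r ∈ Finset.Icc 1 (P / n),
      ((min P ⌊T₂ * n / (2 * π * m * (n * r : ℕ))⌋₊ + 1 - ⌈T * n / (2 * π * m * (n * r : ℕ))⌉₊ : ℕ) : ℂ) =
      (((((min P ⌊T₂ / (2 * π * m * r)⌋₊ + 1 - ⌈T / (2 * π * m * r)⌉₊ : ℕ) : ℕ) : ℝ)) : ℂ) := by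
    intro r hr
    have hr0 : (0 : ℝ) < r := by exact_mod_cast (Finset.mem_Icc.1 hr).1
    have e1 : T₂ * n / (2 * π * m * (n * r : ℕ)) = T₂ / (2 * π * m * r) := by
      push_cast; field_simp
    have e2 : T * n / (2 * π * m * (n * r : ℕ)) = T / (2 * π * m * r) := by
      push_cast; field_simp
    rw [e1, e2]
    exact (Complex.ofReal_natCast _).symm
  have hR : P / n ≤ P := Nat.div_le_self P n
  have hCount := lemma922_count_sum (R := P / n) hT0 hTT₂ hP hPT hm (hmX.trans hXP) hR
  -- assemble
  have hcoef : 2 * π * Real.sqrt (m / n) * (U / (2 * π * m)) = U / Real.sqrt (m * n) :=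
    two_pi_sqrt_mul_div hm0 hn0 U
  -- name the pieces
  set SS := ∑ μ ∈ Finset.Icc 1 P, ∑ ν ∈ Finset.Icc 1 P, w μ ν * Ic μ ν with hSS
  set Δ := ∑ μ ∈ Finset.Icc 1 P, ∑ ν ∈ Finset.Icc 1 P, w μ ν * (Ic μ ν - Mt μ ν) with hΔ
  set MM := ∑ μ ∈ Finset.Icc 1 P, ∑ ν ∈ Finset.Icc 1 P, w μ ν * Mt μ ν with hMM
  set EE := ∑ μ ∈ Finset.Icc 1 P,
    ∑ ν ∈ Finset.Icc ⌈T * n / (2 * π * m * μ)⌉₊ (min P ⌊T₂ * n / (2 * π * m * μ)⌋₊), ee μ ν with hEE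
  set CC := ∑ r ∈ Finset.Icc 1 (P / n),
    ((min P ⌊T₂ * n / (2 * π * m * (n * r : ℕ))⌋₊ + 1 - ⌈T * n / (2 * π * m * (n * r : ℕ))⌉₊ : ℕ) : ℂ) with hCC
  set CR := ∑ r ∈ Finset.Icc 1 (P / n),
    (((min P ⌊T₂ / (2 * π * m * r)⌋₊ + 1 - ⌈T / (2 * π * m * r)⌉₊ : ℕ) : ℕ) : ℝ) with hCR
  set H := ∑ r ∈ Finset.Icc ⌈T / (2 * π * m * P)⌉₊ (P / n), (1 : ℝ) / r with hH
  set κ : ℝ := 2 * π * Real.sqrt (m / n) with hκ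
  have hκ0 : 0 ≤ κ := by positivity
  have hκX : κ ≤ 2 * π * Real.sqrt X := by
    rw [hκ]
    refine mul_le_mul_of_nonneg_left (Real.sqrt_le_sqrt ?_) (by positivity)
    exact (div_le_self (Nat.cast_nonneg m) (by exact_mod_cast hn)).trans hmX
  have hSSsplit : SS = Δ + MM := by
    simp only [hSS, hΔ, hMM, ← Finset.sum_add_distrib]
    refine Finset.sum_congr rfl fun μ _ => Finset.sum_congr rfl fun ν _ => by ring
  have hCCR : CC = (CR : ℂ) := by
    rw [hCC, hCR, Complex.ofReal_sum]
    exact Finset.sum_congr rfl hcount_eq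
  -- the identity `J − (U/√(mn)) H = e4 Δ + κ (CR − (U/(2πm)) H) + κ (EE − CC)`
  have hident : e4 * SS - (((U / Real.sqrt (m * n)) * H : ℝ) : ℂ) =
      e4 * Δ + (κ : ℂ) * (((CR - U / (2 * π * m) * H : ℝ)) : ℂ) + (κ : ℂ) * (EE - CC) := by
    rw [hSSsplit, mul_add, hMain, hCCR, ← hcoef]
    push_cast
    ring
  rw [hJ, show cexp (-(I * ((π / 4 : ℝ) : ℂ))) = e4 from rfl, hident]
  -- bounds for the three pieces
  have h1 : ‖e4 * Δ‖ ≤ 160 * T ^ (2 / 5 : ℝ) * P + 480 * P + 440 * Real.sqrt X * P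
      + 320 * Real.sqrt (T * X) * (1 + Real.log P) * (2 + Real.log P + Real.log (3 * T * X)) := by
    rw [norm_mul, he4n, one_mul, hΔ]
    exact hErr
  have h2 : ‖(κ : ℂ) * (((CR - U / (2 * π * m) * H : ℝ)) : ℂ)‖ ≤
      κ * ((P : ℝ) + (U / (2 * π * P) + 1) * (U * P / T)) := by
    rw [norm_mul, Complex.norm_real, Complex.norm_real, Real.norm_eq_abs, Real.norm_eq_abs,
      abs_of_nonneg hκ0]
    refine mul_le_mul_of_nonneg_left ?_ hκ0
    have hC := hCount
    rw [← hUdef] at hC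
    refine hC.trans ?_
    have hRP : ((P / n : ℕ) : ℝ) ≤ P := by exact_mod_cast hR
    have hmono : U / (2 * π * m * P) ≤ U / (2 * π * P) := by
      refine div_le_div_of_nonneg_left hU (by positivity) ?_
      have h1m : (1 : ℝ) ≤ m := by exact_mod_cast hm
      calc 2 * π * (P : ℝ) = 2 * π * 1 * P := by ring
        _ ≤ 2 * π * m * P := by gcongr
    have hUP : 0 ≤ U * P / T := by positivity
    nlinarith [mul_le_mul_of_nonneg_right hmono hUP]
  have h3 : ‖(κ : ℂ) * (EE - CC)‖ ≤ κ * ((P : ℝ) * n / 2) := by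
    rw [norm_mul, Complex.norm_real, Real.norm_eq_abs, abs_of_nonneg hκ0]
    refine mul_le_mul_of_nonneg_left ?_ hκ0
    rw [hEE, hCC]
    exact hSplit
  have hnX' : (P : ℝ) * n / 2 ≤ P * X / 2 := by nlinarith
  calc ‖e4 * Δ + (κ : ℂ) * (((CR - U / (2 * π * m) * H : ℝ)) : ℂ) + (κ : ℂ) * (EE - CC)‖
      ≤ ‖e4 * Δ‖ + ‖(κ : ℂ) * (((CR - U / (2 * π * m) * H : ℝ)) : ℂ)‖ + ‖(κ : ℂ) * (EE - CC)‖ :=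
        norm_add₃_le
    _ ≤ (160 * T ^ (2 / 5 : ℝ) * P + 480 * P + 440 * Real.sqrt X * P
          + 320 * Real.sqrt (T * X) * (1 + Real.log P) * (2 + Real.log P + Real.log (3 * T * X)))
        + κ * ((P : ℝ) + (U / (2 * π * P) + 1) * (U * P / T)) + κ * ((P : ℝ) * X / 2) := by
        refine add_le_add (add_le_add h1 h2) (h3.trans (mul_le_mul_of_nonneg_left hnX' hκ0))
    _ = (160 * T ^ (2 / 5 : ℝ) * P + 480 * P + 440 * Real.sqrt X * P
          + 320 * Real.sqrt (T * X) * (1 + Real.log P) * (2 + Real.log P + Real.log (3 * T * X)))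
        + κ * ((P : ℝ) + P * X / 2 + (U / (2 * π * P) + 1) * (U * P / T)) := by ring
    _ ≤ _ := by
        have hin : 0 ≤ (P : ℝ) + P * X / 2 + (U / (2 * π * P) + 1) * (U * P / T) := by positivity
        have := mul_le_mul_of_nonneg_right hκX hin
        linarith

end Literature.NumberTheory.LFunctions.TwistedMoment
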